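import Literature.NumberTheory.BeurlingPrimes.WeightedPrimeSums
import Mathlib.NumberTheory.Chebyshev
import Mathlib.NumberTheory.AbelSummation
import Mathlib.Analysis.SpecialFunctions.Pow.Deriv
import Mathlib.Analysis.SpecialFunctions.Integrals.Basic
import Mathlib.Analysis.SumIntegralComparisons
import HarnessLib

/-!
# The template `F(x) = Σ_{p ≤ x} p^{α−1}` of Broucke–Debruyne–Révész: Chebyshev-type bounds

Topic `Literature/NumberTheory/BeurlingPrimes`, grouping namespace `PrimeWeight`. Everything in this file is
PROVED.

In §5 of Broucke–Debruyne–Révész (arXiv:2309.01567, p. 15) the primes to be deleted are sampled from the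
template `F(x) = ∫₁ˣ u^{α−1} dπ(u) = Σ_{p ≤ x} p^{α−1}` (we drop BDR's bounded-variation correction `dE`, which
only serves BV's quantile scheme), and "the prime number theorem yields `F(x) ∼ Li(x^α)`", i.e. `F(x) ≍ x^α/log x`.
Only the ORDER of `F` is used downstream, and we derive it from Chebyshev's bounds (Mathlib
`Chebyshev.theta_le_log4_mul_x`, `Chebyshev.pi_ge'`) by Abel summation (Mathlib `sum_mul_eq_sub_integral_mul₁`):

* `logPowSum α x = Σ_{p ≤ x} p^{α−1} log p ≤ (log 4/α) x^α` (`logPowSum_le`);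
* `powCount α x = Σ_{p ≤ x} p^{α−1}` (`= wcount (powWeight α)`): `powCount α x ≤ x^α/α + 1` for `x ≥ 0`
  (`powCount_le_rpow`), `powCount α x ≤ C_α x^α/log x` for `x ≥ 2`, `1/2 < α < 1` (`powCount_le`), and
  `powCount α x ≥ c x^α/log x` for `x ≥ x₀` (`exists_le_powCount`);
* the variance proxy `powVar α x = Σ_{p ≤ x} p^{α−1}(1 − p^{α−1})` of the Bernoulli selection:
  `(1 − 2^{α−1}) powCount ≤ powVar ≤ powCount` (`powVar_le`, `le_powVar`).

## References
* [BrouckeDebruyneRevesz2023] F. Broucke, G. Debruyne, Sz. Gy. Révész, *Some examples of well-behaved Beurling number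
  systems*, arXiv:2309.01567, §5 p. 15 ("`F(x) = Li(x^α)(1+o(1)) … ∼ Li(x^α)`", "`Q(x) ∼ x^α/(α log x)`") (read).
-/

noncomputable section

open Set Filter MeasureTheory Finset
open scoped Topology Chebyshev

namespace Literature.NumberTheory.BeurlingPrimes

namespace PrimeWeight

/-! ### The weights `p^{α−1}` and the sums `F`, `G`, `V` -/

/-- The template weight `p^{α−1}` (the selection probability of the prime `p`). [cite: BrouckeDebruyneRevesz2023, §5 p. 15] -/
def powWeight (α : ℝ) (p : ℕ) : ℝ := (p : ℝ) ^ (α - 1)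

/-- **`F(x) = Σ_{p ≤ x} p^{α−1}`** (BDR's `∫₁ˣ u^{α−1} dπ(u)`). [cite: BrouckeDebruyneRevesz2023, §5 p. 15] -/
def powCount (α : ℝ) (x : ℝ) : ℝ := ∑ p ∈ primesUpTo x, (p : ℝ) ^ (α - 1)

/-- `G(x) = Σ_{p ≤ x} p^{α−1} log p` (the `θ`-weighted companion of `F`). [cite: BrouckeDebruyneRevesz2023, §5 p. 15] -/
def logPowSum (α : ℝ) (x : ℝ) : ℝ := ∑ p ∈ primesUpTo x, (p : ℝ) ^ (α - 1) * Real.log p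

/-- The variance proxy `V(x) = Σ_{p ≤ x} p^{α−1}(1 − p^{α−1})` of independent Bernoulli(`p^{α−1}`) selections.
[cite: BrouckeDebruyneRevesz2023, §5 p. 15] -/
def powVar (α : ℝ) (x : ℝ) : ℝ := ∑ p ∈ primesUpTo x, (p : ℝ) ^ (α - 1) * (1 - (p : ℝ) ^ (α - 1))

/-- `F = wcount (powWeight α)`. [folklore] -/
theorem wcount_powWeight (α x : ℝ) : wcount (powWeight α) x = powCount α x := rfl

variable {α : ℝ}

/-- `0 < p^{α−1}` for a prime `p`. [folklore] -/
theorem powWeight_pos {p : ℕ} (hp : p.Prime) (α : ℝ) : 0 < (p : ℝ) ^ (α - 1) :=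
  Real.rpow_pos_of_pos (by exact_mod_cast hp.pos) _

/-- `p^{α−1} ≤ 2^{α−1}` for a prime `p` and `α ≤ 1`. [folklore] -/
theorem powWeight_le_two_rpow {p : ℕ} (hp : p.Prime) (hα : α ≤ 1) : (p : ℝ) ^ (α - 1) ≤ (2 : ℝ) ^ (α - 1) :=
  Real.rpow_le_rpow_of_nonpos (by norm_num) (by exact_mod_cast hp.two_le) (by linarith)

/-- `2^{α−1} < 1` for `α < 1`. [folklore] -/
theorem two_rpow_lt_one (hα : α < 1) : (2 : ℝ) ^ (α - 1) < 1 :=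
  Real.rpow_lt_one_of_one_lt_of_neg (by norm_num) (by linarith)

/-- `p^{α−1} ≤ 1` for a prime `p` and `α ≤ 1`. [folklore] -/
theorem powWeight_le_one {p : ℕ} (hp : p.Prime) (hα : α ≤ 1) : (p : ℝ) ^ (α - 1) ≤ 1 :=
  Real.rpow_le_one_of_one_le_of_nonpos (by exact_mod_cast hp.one_lt.le) (by linarith)

/-- `F(x) ≥ 0`. [folklore] -/
theorem powCount_nonneg (α x : ℝ) : 0 ≤ powCount α x :=
  Finset.sum_nonneg fun _ hp ↦ (powWeight_pos (mem_primesUpTo.mp hp).1 α).le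

/-- `G(x) ≥ 0`. [folklore] -/
theorem logPowSum_nonneg (α x : ℝ) : 0 ≤ logPowSum α x :=
  Finset.sum_nonneg fun p hp ↦ mul_nonneg (powWeight_pos (mem_primesUpTo.mp hp).1 α).le
    (Real.log_nonneg (by exact_mod_cast (mem_primesUpTo.mp hp).1.one_lt.le))

/-- `F` is monotone. [folklore] -/
theorem powCount_mono (α : ℝ) : Monotone (powCount α) := fun _ _ hxy ↦
  Finset.sum_le_sum_of_subset_of_nonneg (primesUpTo_mono hxy) fun _ hp _ ↦
    (powWeight_pos (mem_primesUpTo.mp hp).1 α).le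

/-- `F(x) = 0` for `x < 2`. [folklore] -/
theorem powCount_eq_zero_of_lt_two {x : ℝ} (hx : x < 2) : powCount α x = 0 := by
  unfold powCount
  have : primesUpTo x = ∅ := Finset.eq_empty_of_forall_notMem fun p hp ↦ by
    rw [mem_primesUpTo] at hp
    have := hp.1.two_le
    have : (2 : ℝ) ≤ p := by exact_mod_cast this
    linarith
  rw [this, Finset.sum_empty]

/-! ### `V` versus `F` -/

/-- `V(x) ≤ F(x)`. [folklore] -/
theorem powVar_le (hα : α ≤ 1) (x : ℝ) : powVar α x ≤ powCount α x := by
  unfold powVar powCount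
  refine Finset.sum_le_sum fun p hp ↦ ?_
  have h0 := powWeight_pos (mem_primesUpTo.mp hp).1 α
  have h1 := powWeight_le_one (mem_primesUpTo.mp hp).1 hα
  nlinarith

/-- `(1 − 2^{α−1}) F(x) ≤ V(x)`. [folklore] -/
theorem le_powVar (hα : α ≤ 1) (x : ℝ) : (1 - (2 : ℝ) ^ (α - 1)) * powCount α x ≤ powVar α x := by
  unfold powVar powCount
  rw [Finset.mul_sum]
  refine Finset.sum_le_sum fun p hp ↦ ?_
  have h0 := powWeight_pos (mem_primesUpTo.mp hp).1 α
  have h2 := powWeight_le_two_rpow (mem_primesUpTo.mp hp).1 hα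
  nlinarith

/-- `V(x) ≥ 0` (`α ≤ 1`). [folklore] -/
theorem powVar_nonneg (hα : α ≤ 1) (x : ℝ) : 0 ≤ powVar α x := by
  unfold powVar
  refine Finset.sum_nonneg fun p hp ↦ ?_
  have h0 := powWeight_pos (mem_primesUpTo.mp hp).1 α
  have h1 := powWeight_le_one (mem_primesUpTo.mp hp).1 hα
  nlinarith

/-! ### `G(x) ≤ (log 4/α) x^α` by Abel summation -/

/-- The coefficient sequence `c(n) = 1_{n prime} log n` (partial sums `θ`). [folklore] -/
def thetaCoeff (n : ℕ) : ℝ := if n.Prime then Real.log n else 0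

/-- `Σ_{k ≤ ⌊t⌋₊} c(k) = θ(t)`. [folklore] -/
theorem sum_thetaCoeff (t : ℝ) : ∑ k ∈ Icc 0 ⌊t⌋₊, thetaCoeff k = θ t := by
  rw [Chebyshev.theta_eq_sum_Icc, Finset.sum_filter]
  rfl

/-- **`G(x) ≤ (log 4/α) x^α`** for `0 < α ≤ 1`, `x ≥ 2`: Abel summation
`G(x) = θ(x)x^{α−1} + (1−α)∫₂ˣ θ(t) t^{α−2} dt` and `θ(t) ≤ (log 4) t`. [cite: BrouckeDebruyneRevesz2023, §5 p. 15] -/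
theorem logPowSum_le (hα0 : 0 < α) (hα : α ≤ 1) {x : ℝ} (hx : 2 ≤ x) :
    logPowSum α x ≤ Real.log 4 / α * x ^ α := by
  have hx0 : 0 < x := by linarith
  have hl4 : 0 < Real.log 4 := Real.log_pos (by norm_num)
  set f : ℝ → ℝ := fun u ↦ u ^ (α - 1) with hf
  -- the derivative of `f` on `t > 0`
  have hderiv : ∀ t : ℝ, 0 < t → HasDerivAt f ((α - 1) * t ^ (α - 1 - 1)) t := fun t ht ↦ by
    simpa [hf] using Real.hasDerivAt_rpow_const (x := t) (p := α - 1) (Or.inl ht.ne')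
  have hderiv_eq : ∀ t ∈ Set.Icc (2 : ℝ) x, deriv f t = (α - 1) * t ^ (α - 2) := fun t ht ↦ by
    rw [(hderiv t (by linarith [ht.1])).deriv]; congr 1; ring_nf
  have hf_diff : ∀ t ∈ Set.Icc (2 : ℝ) x, DifferentiableAt ℝ f t := fun t ht ↦
    (hderiv t (by linarith [ht.1])).differentiableAt
  have hcont : ContinuousOn (fun t : ℝ ↦ (α - 1) * t ^ (α - 2)) (Set.Icc 2 x) :=
    ContinuousOn.mul continuousOn_const (ContinuousOn.rpow_const continuousOn_id fun t ht ↦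
      Or.inl (ne_of_gt (show (0 : ℝ) < t by linarith [ht.1])))
  have hf_int : IntegrableOn (deriv f) (Set.Icc 2 x) :=
    (hcont.integrableOn_Icc).congr_fun (fun t ht ↦ (hderiv_eq t ht).symm) measurableSet_Icc
  -- Abel summation
  have habel := sum_mul_eq_sub_integral_mul₁ thetaCoeff (f := f) (by simp [thetaCoeff, Nat.not_prime_zero])
    (by simp [thetaCoeff, Nat.not_prime_one]) x hf_diff hf_int
  have hlhs : ∑ k ∈ Icc 0 ⌊x⌋₊, f k * thetaCoeff k = logPowSum α x := by
    unfold logPowSum thetaCoeff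
    rw [primesUpTo_eq_filter, Nat.range_succ_eq_Icc_zero, Finset.sum_filter]
    refine Finset.sum_congr rfl fun k _ ↦ ?_
    split_ifs with h <;> simp [hf]
  rw [hlhs] at habel
  simp only [sum_thetaCoeff] at habel
  -- the integral term: `-∫ deriv f · θ = (1−α)∫ t^{α−2} θ(t) ≤ (1−α) log 4 ∫ t^{α−1}`
  have hθint : IntegrableOn (fun t : ℝ ↦ deriv f t * θ t) (Set.Icc 2 x) := by
    have := integrableOn_mul_sum_Icc thetaCoeff (m := 0) (by norm_num : (0 : ℝ) ≤ 2) hf_int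
    refine this.congr_fun (fun t _ ↦ ?_) measurableSet_Icc
    simp only [sum_thetaCoeff]
  have hθint' : IntegrableOn (fun t : ℝ ↦ deriv f t * θ t) (Set.Ioc 2 x) := hθint.mono_set Set.Ioc_subset_Icc_self
  have hmajcont : ContinuousOn (fun t : ℝ ↦ (1 - α) * Real.log 4 * t ^ (α - 1)) (Set.Icc 2 x) :=
    ContinuousOn.mul continuousOn_const (ContinuousOn.rpow_const continuousOn_id fun t ht ↦
      Or.inl (ne_of_gt (show (0 : ℝ) < t by linarith [ht.1])))
  have hmajint : IntegrableOn (fun t : ℝ ↦ (1 - α) * Real.log 4 * t ^ (α - 1)) (Set.Ioc 2 x) :=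
    hmajcont.integrableOn_Icc.mono_set Set.Ioc_subset_Icc_self
  have hint_le : -(∫ t in Set.Ioc 2 x, deriv f t * θ t) ≤ ∫ t in Set.Ioc 2 x, (1 - α) * Real.log 4 * t ^ (α - 1) := by
    rw [← integral_neg]
    refine setIntegral_mono_on hθint'.neg hmajint measurableSet_Ioc fun t ht ↦ ?_
    have ht0 : 0 < t := by linarith [ht.1]
    rw [hderiv_eq t ⟨ht.1.le, ht.2⟩]
    have hθ := Chebyshev.theta_le_log4_mul_x ht0.le
    have hθ0 := Chebyshev.theta_nonneg t
    have hpow : t ^ (α - 2) * t = t ^ (α - 1) := by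
      rw [← Real.rpow_add_one ht0.ne']; ring_nf
    have hp0 : 0 ≤ t ^ (α - 2) := (Real.rpow_pos_of_pos ht0 _).le
    calc -((α - 1) * t ^ (α - 2) * θ t) = (1 - α) * (t ^ (α - 2) * θ t) := by ring
      _ ≤ (1 - α) * (t ^ (α - 2) * (Real.log 4 * t)) :=
          mul_le_mul_of_nonneg_left (mul_le_mul_of_nonneg_left hθ hp0) (by linarith)
      _ = (1 - α) * Real.log 4 * t ^ (α - 1) := by rw [← hpow]; ring
  have hint_val : ∫ t in Set.Ioc 2 x, (1 - α) * Real.log 4 * t ^ (α - 1) ≤ (1 - α) * Real.log 4 * (x ^ α / α) := by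
    rw [MeasureTheory.integral_const_mul, ← intervalIntegral.integral_of_le hx,
      integral_rpow (Or.inl (by linarith : (-1 : ℝ) < α - 1))]
    refine mul_le_mul_of_nonneg_left ?_ (mul_nonneg (by linarith) hl4.le)
    rw [show α - 1 + 1 = α by ring]
    have h2 : 0 ≤ (2 : ℝ) ^ α := (Real.rpow_pos_of_pos (by norm_num) _).le
    rw [div_le_div_iff_of_pos_right hα0]
    linarith
  -- the boundary term
  have hbd : f x * θ x ≤ Real.log 4 * x ^ α := by
    have hθ := Chebyshev.theta_le_log4_mul_x hx0.le
    have hp0 : 0 ≤ x ^ (α - 1) := (Real.rpow_pos_of_pos hx0 _).le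
    have hpow : x ^ (α - 1) * x = x ^ α := by rw [← Real.rpow_add_one hx0.ne']; ring_nf
    calc f x * θ x = x ^ (α - 1) * θ x := rfl
      _ ≤ x ^ (α - 1) * (Real.log 4 * x) := mul_le_mul_of_nonneg_left hθ hp0
      _ = Real.log 4 * x ^ α := by rw [← hpow]; ring
  have hxα : 0 ≤ x ^ α := (Real.rpow_pos_of_pos hx0 _).le
  calc logPowSum α x = f x * θ x - ∫ t in Set.Ioc 2 x, deriv f t * θ t := habel
    _ ≤ Real.log 4 * x ^ α + (1 - α) * Real.log 4 * (x ^ α / α) := by linarith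
    _ = Real.log 4 / α * x ^ α := by field_simp; ring

/-! ### Bounds for `F` -/

/-- **Crude bound `F(x) ≤ x^α/α + 1`** for `0 < α ≤ 1`, `x ≥ 0` (`Σ_{2 ≤ n ≤ x} n^{α−1} ≤ ∫₁ˣ u^{α−1} du`).
[cite: BrouckeDebruyneRevesz2023, §5 p. 15] -/
theorem powCount_le_rpow (hα0 : 0 < α) (hα : α ≤ 1) {x : ℝ} (hx : 0 ≤ x) : powCount α x ≤ x ^ α / α + 1 := by
  rcases lt_or_ge x 2 with hx2 | hx2
  · rw [powCount_eq_zero_of_lt_two hx2]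
    have : 0 ≤ x ^ α / α := div_nonneg (Real.rpow_nonneg hx _) hα0.le
    linarith
  set N := ⌊x⌋₊ with hN
  have hN1 : 1 ≤ N := Nat.le_floor (by simp; linarith)
  -- primes `≤ x` are among `2, …, N`
  have hsub : primesUpTo x ⊆ Finset.Icc 2 N := fun p hp ↦ by
    rw [primesUpTo, Nat.mem_primesLE] at hp
    exact Finset.mem_Icc.mpr ⟨hp.2.two_le, hp.1⟩
  have h1 : powCount α x ≤ ∑ n ∈ Finset.Icc 2 N, (n : ℝ) ^ (α - 1) :=
    Finset.sum_le_sum_of_subset_of_nonneg hsub fun n hn _ ↦ Real.rpow_nonneg (Nat.cast_nonneg n) _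
  -- `Σ_{n=2}^{N} n^{α−1} = Σ_{i ∈ Ico 1 N} (i+1)^{α−1} ≤ ∫₁^N u^{α−1} du`
  have h2 : ∑ n ∈ Finset.Icc 2 N, (n : ℝ) ^ (α - 1) = ∑ i ∈ Finset.Ico 1 N, ((i + 1 : ℕ) : ℝ) ^ (α - 1) := by
    have : Finset.Icc 2 N = Finset.image (· + 1) (Finset.Ico 1 N) := by
      ext n
      simp only [Finset.mem_Icc, Finset.mem_image, Finset.mem_Ico]
      constructor
      · rintro ⟨h1, h2⟩; exact ⟨n - 1, ⟨by omega, by omega⟩, by omega⟩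
      · rintro ⟨i, ⟨h1, h2⟩, rfl⟩; exact ⟨by omega, by omega⟩
    rw [this, Finset.sum_image fun a _ b _ h ↦ by simpa using h]
  have hanti : AntitoneOn (fun u : ℝ ↦ u ^ (α - 1)) (Set.Icc (1 : ℕ) (N : ℕ)) := by
    intro u hu v hv huv
    simp only [Nat.cast_one] at hu hv
    exact Real.rpow_le_rpow_of_nonpos (by linarith [hu.1]) huv (by linarith)
  have h3 := AntitoneOn.sum_le_integral_Ico hN1 hanti
  have h4 : ∫ u in ((1 : ℕ) : ℝ)..(N : ℕ), u ^ (α - 1) = ((N : ℝ) ^ α - 1) / α := by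
    rw [Nat.cast_one, integral_rpow (Or.inl (by linarith : (-1 : ℝ) < α - 1))]
    simp [show α - 1 + 1 = α by ring]
  have hNx : (N : ℝ) ^ α ≤ x ^ α := Real.rpow_le_rpow (Nat.cast_nonneg N) (Nat.floor_le hx) hα0.le
  have h5 : ((N : ℝ) ^ α - 1) / α ≤ x ^ α / α := div_le_div_of_nonneg_right (by linarith) hα0.le
  calc powCount α x ≤ ∑ n ∈ Finset.Icc 2 N, (n : ℝ) ^ (α - 1) := h1
    _ = ∑ i ∈ Finset.Ico 1 N, ((i + 1 : ℕ) : ℝ) ^ (α - 1) := h2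
    _ ≤ ∫ u in ((1 : ℕ) : ℝ)..(N : ℕ), u ^ (α - 1) := h3
    _ = ((N : ℝ) ^ α - 1) / α := h4
    _ ≤ x ^ α / α := h5
    _ ≤ x ^ α / α + 1 := by linarith

/-- **`F(x) ≤ C_α x^α/log x`** for `1/2 < α ≤ 1` and `x ≥ 2`, with `C_α = 2 log 4/α + 1/(α − 1/2)`: split at `√x`,
`F(x) ≤ π(√x) + (log √x)^{−1} G(x) ≤ √x + (2/log x)(log 4/α) x^α`, and `√x log x ≤ x^α/(α−1/2)`.
[cite: BrouckeDebruyneRevesz2023, §5 p. 15 ("`F(x) ∼ Li(x^α)`")] -/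
theorem powCount_le (hα : 1 / 2 < α) (hα1 : α ≤ 1) {x : ℝ} (hx : 2 ≤ x) :
    powCount α x ≤ (2 * Real.log 4 / α + 1 / (α - 1 / 2)) * (x ^ α / Real.log x) := by
  have hx0 : 0 < x := by linarith
  have hα0 : 0 < α := by linarith
  have hlx : 0 < Real.log x := Real.log_pos (by linarith)
  have hl4 : 0 < Real.log 4 := Real.log_pos (by norm_num)
  set y : ℝ := Real.sqrt x with hy
  have hy0 : 0 < y := Real.sqrt_pos.mpr hx0
  have hy1 : 1 < y := by
    rw [hy, show (1 : ℝ) = Real.sqrt 1 by simp]; exact Real.sqrt_lt_sqrt (by norm_num) (by linarith)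
  have hyx : y ≤ x := by
    rw [hy, Real.sqrt_le_left (by linarith)]; nlinarith
  have hlogy : Real.log y = Real.log x / 2 := by
    rw [hy, Real.sqrt_eq_rpow, Real.log_rpow hx0]; ring
  have hlogy0 : 0 < Real.log y := by rw [hlogy]; linarith
  classical
  -- split the sum at `y`
  have hsplit : powCount α x = ∑ p ∈ (primesUpTo x).filter (fun p : ℕ ↦ (p : ℝ) ≤ y), (p : ℝ) ^ (α - 1) +
      ∑ p ∈ (primesUpTo x).filter (fun p : ℕ ↦ ¬ (p : ℝ) ≤ y), (p : ℝ) ^ (α - 1) := by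
    unfold powCount; rw [Finset.sum_filter_add_sum_filter_not]
  -- small primes: at most `#primesUpTo y ≤ y` terms, each `≤ 1`
  have hsmall : ∑ p ∈ (primesUpTo x).filter (fun p : ℕ ↦ (p : ℝ) ≤ y), (p : ℝ) ^ (α - 1) ≤ y := by
    rw [← primesUpTo_eq_filter_le hyx]
    calc ∑ p ∈ primesUpTo y, (p : ℝ) ^ (α - 1) ≤ ∑ p ∈ primesUpTo y, (1 : ℝ) :=
          Finset.sum_le_sum fun p hp ↦ powWeight_le_one (mem_primesUpTo.mp hp).1 hα1
      _ = (primesUpTo y).card := by simp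
      _ ≤ y := card_primesUpTo_le hy0.le
  -- large primes: `p^{α−1} ≤ p^{α−1} log p / log y`
  have hlarge : ∑ p ∈ (primesUpTo x).filter (fun p : ℕ ↦ ¬ (p : ℝ) ≤ y), (p : ℝ) ^ (α - 1) ≤
      logPowSum α x / Real.log y := by
    have h1 : ∑ p ∈ (primesUpTo x).filter (fun p : ℕ ↦ ¬ (p : ℝ) ≤ y), (p : ℝ) ^ (α - 1) ≤
        ∑ p ∈ (primesUpTo x).filter (fun p : ℕ ↦ ¬ (p : ℝ) ≤ y), (p : ℝ) ^ (α - 1) * Real.log p / Real.log y := by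
      refine Finset.sum_le_sum fun p hp ↦ ?_
      rw [Finset.mem_filter, not_le] at hp
      have hp0 : (0 : ℝ) < p := lt_trans hy0 hp.2
      have hlogp : Real.log y ≤ Real.log p := Real.log_le_log hy0 hp.2.le
      have hw := powWeight_pos (mem_primesUpTo.mp hp.1).1 α
      rw [le_div_iff₀ hlogy0]
      exact mul_le_mul_of_nonneg_left hlogp hw.le
    have h2 : ∑ p ∈ (primesUpTo x).filter (fun p : ℕ ↦ ¬ (p : ℝ) ≤ y), (p : ℝ) ^ (α - 1) * Real.log p / Real.log y ≤
        logPowSum α x / Real.log y := by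
      unfold logPowSum
      rw [Finset.sum_div]
      refine Finset.sum_le_sum_of_subset_of_nonneg (Finset.filter_subset _ _) fun p hp _ ↦ ?_
      exact div_nonneg (mul_nonneg (powWeight_pos (mem_primesUpTo.mp hp).1 α).le
        (Real.log_nonneg (by exact_mod_cast (mem_primesUpTo.mp hp).1.one_lt.le))) hlogy0.le
    exact h1.trans h2
  have hG := logPowSum_le hα0 hα1 hx
  have hxα : 0 < x ^ α := Real.rpow_pos_of_pos hx0 _
  -- `y = √x ≤ x^α/((α − 1/2) log x)`
  have hysmall : y ≤ 1 / (α - 1 / 2) * (x ^ α / Real.log x) := by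
    have hε : 0 < α - 1 / 2 := by linarith
    have hlog := Real.log_le_rpow_div hx0.le hε
    -- `y · log x ≤ y · x^{α−1/2}/(α−1/2) = x^α/(α−1/2)`
    have hyid : y * x ^ (α - 1 / 2) = x ^ α := by
      rw [hy, Real.sqrt_eq_rpow, ← Real.rpow_add hx0]; ring_nf
    have h1 : y * Real.log x ≤ x ^ α / (α - 1 / 2) := by
      calc y * Real.log x ≤ y * (x ^ (α - 1 / 2) / (α - 1 / 2)) := mul_le_mul_of_nonneg_left hlog hy0.le
        _ = x ^ α / (α - 1 / 2) := by rw [← hyid]; ring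
    rw [show 1 / (α - 1 / 2) * (x ^ α / Real.log x) = (x ^ α / (α - 1 / 2)) / Real.log x by ring,
      le_div_iff₀ hlx]
    exact h1
  have hlarge' : logPowSum α x / Real.log y ≤ 2 * Real.log 4 / α * (x ^ α / Real.log x) := by
    rw [hlogy, div_le_iff₀ (by linarith)]
    calc logPowSum α x ≤ Real.log 4 / α * x ^ α := hG
      _ = 2 * Real.log 4 / α * (x ^ α / Real.log x) * (Real.log x / 2) := by field_simp
  rw [hsplit, add_mul]
  linarith [hsmall, hlarge, hlarge', hysmall]

/-- `(x − 1) log 2 − log(x + 2) ≥ (log 2/2) x` for all large `x`. [folklore] -/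
theorem eventually_chebyshev_numerator :
    ∀ᶠ x : ℝ in atTop, Real.log 2 / 2 * x ≤ (x - 1) * Real.log 2 - Real.log (x + 2) := by
  -- `log(x+2)/(x+2) → 0`, hence `log(x+2) ≤ (log 2/4)(x+2)` eventually; and `log 2 + (log 2/4)(x+2) ≤ (log 2/2) x`
  -- for `x ≥ 6`
  have hl2 : 0 < Real.log 2 := Real.log_pos (by norm_num)
  have h0 : Tendsto (fun u : ℝ ↦ Real.log u / u) atTop (𝓝 0) := by
    have := Real.tendsto_pow_log_div_mul_add_atTop 1 0 1 one_ne_zero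
    simpa using this
  have h1 : Tendsto (fun x : ℝ ↦ Real.log (x + 2) / (x + 2)) atTop (𝓝 0) :=
    h0.comp (tendsto_atTop_add_const_right atTop 2 tendsto_id)
  have h2 : ∀ᶠ x : ℝ in atTop, Real.log (x + 2) / (x + 2) ≤ Real.log 2 / 4 :=
    (h1.eventually (ge_mem_nhds (by positivity)))
  filter_upwards [h2, eventually_ge_atTop (6 : ℝ)] with x hx hx6
  rw [div_le_iff₀ (by linarith)] at hx
  nlinarith

/-- **`F(x) ≥ c x^α/log x` for large `x`** (`F(x) ≥ x^{α−1} π(x)` and Chebyshev's `π(x) ≫ x/log x`, Mathlib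
`Chebyshev.pi_ge'`): there are `x₀` and `c > 0` with `c x^α/log x ≤ F(x)` for `x ≥ x₀`.
[cite: BrouckeDebruyneRevesz2023, §5 p. 15 ("`π_𝒮(x) ≍ x^α/log x`")] -/
theorem exists_le_powCount (hα1 : α ≤ 1) :
    ∃ x₀ c : ℝ, 0 < c ∧ ∀ x : ℝ, x₀ ≤ x → c * (x ^ α / Real.log x) ≤ powCount α x := by
  have hl2 : 0 < Real.log 2 := Real.log_pos (by norm_num)
  obtain ⟨x₁, hx₁⟩ := (eventually_chebyshev_numerator.and (eventually_ge_atTop (2 : ℝ))).exists_forall_of_atTop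
  refine ⟨x₁, Real.log 2 / 2, by positivity, fun x hx ↦ ?_⟩
  obtain ⟨hnum, hx2⟩ := hx₁ x hx
  have hx0 : 0 < x := by linarith
  have hlx : 0 < Real.log x := Real.log_pos (by linarith)
  -- `π(⌊x⌋₊) ≥ ((x−1) log 2 − log(x+2))/log x ≥ (log 2/2) x/log x`
  have hpi := Chebyshev.pi_ge' (show (1 : ℝ) < x by linarith)
  have hpi' : Real.log 2 / 2 * x / Real.log x ≤ (Nat.primeCounting ⌊x⌋₊ : ℝ) :=
    le_trans (div_le_div_of_nonneg_right hnum hlx.le) hpi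
  -- `F(x) ≥ x^{α−1} · #primesUpTo x = x^{α−1} π(⌊x⌋₊)`
  have hF : x ^ (α - 1) * (Nat.primeCounting ⌊x⌋₊ : ℝ) ≤ powCount α x := by
    unfold powCount
    rw [← card_primesUpTo, mul_comm, ← nsmul_eq_mul, ← Finset.sum_const]
    refine Finset.sum_le_sum fun p hp ↦ ?_
    have hp' := mem_primesUpTo.mp hp
    exact Real.rpow_le_rpow_of_nonpos (by exact_mod_cast hp'.1.pos) hp'.2 (by linarith)
  have hxpow : x ^ (α - 1) * x = x ^ α := by rw [← Real.rpow_add_one hx0.ne']; ring_nf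
  have hxa1 : 0 ≤ x ^ (α - 1) := (Real.rpow_pos_of_pos hx0 _).le
  calc Real.log 2 / 2 * (x ^ α / Real.log x) = x ^ (α - 1) * (Real.log 2 / 2 * x / Real.log x) := by
        rw [← hxpow]; ring
    _ ≤ x ^ (α - 1) * (Nat.primeCounting ⌊x⌋₊ : ℝ) := mul_le_mul_of_nonneg_left hpi' hxa1
    _ ≤ powCount α x := hF


/-! ### The selection weight `1_S(p) − p^{α−1}` and the gauge `1 + √log(|t|+2)` -/

open Classical in
/-- The indicator weight `1_S(p)` of a set `S` of primes. [folklore] -/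
def indSet (S : Set ℕ) (p : ℕ) : ℝ := if p ∈ S then 1 else 0

/-- **The comparison weight `c(p) = 1_S(p) − p^{α−1}`** of the deleted primes against the template
(`wsum (selWeight S α) x t = Σ_{p ≤ x, p ∈ S} p^{−it} − Σ_{p ≤ x} p^{α−1} p^{−it}`, BDR's
"`Σ_{p_j ≤ x} p_j^{−it} − ∫₁ˣ u^{−it} dF(u)`"). [cite: BrouckeDebruyneRevesz2023, §5 p. 16 (eq: adjusted)] -/
def selWeight (S : Set ℕ) (α : ℝ) (p : ℕ) : ℝ := indSet S p - (p : ℝ) ^ (α - 1)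

/-- The gauge `g(t) = 1 + √log(|t| + 2)` in `t` of the adjusted estimate. [cite: BrouckeDebruyneRevesz2023, §5 p. 16 (eq: adjusted)] -/
def logGauge (t : ℝ) : ℝ := 1 + Real.sqrt (Real.log (|t| + 2))

/-- `indSet S p ∈ {0, 1}`: `0 ≤ indSet S p ≤ 1`. [folklore] -/
theorem indSet_mem_Icc (S : Set ℕ) (p : ℕ) : indSet S p ∈ Set.Icc (0 : ℝ) 1 := by
  unfold indSet; split_ifs <;> simp

/-- `indSet S p = 1` for `p ∈ S`. [folklore] -/
theorem indSet_of_mem {S : Set ℕ} {p : ℕ} (h : p ∈ S) : indSet S p = 1 := by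
  unfold indSet; rw [if_pos h]

/-- `indSet S p = 0` for `p ∉ S`. [folklore] -/
theorem indSet_of_notMem {S : Set ℕ} {p : ℕ} (h : p ∉ S) : indSet S p = 0 := by
  unfold indSet; rw [if_neg h]

/-- `0 ≤ n^{α−1} ≤ 1` for every natural `n` when `α ≤ 1` (`0^{α−1} ∈ {0,1}`, `n^{α−1} ≤ 1` for `n ≥ 1`). [folklore] -/
theorem natCast_rpow_sub_one_mem_Icc (hα : α ≤ 1) (n : ℕ) : (n : ℝ) ^ (α - 1) ∈ Set.Icc (0 : ℝ) 1 := by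
  refine ⟨Real.rpow_nonneg (Nat.cast_nonneg n) _, ?_⟩
  rcases Nat.eq_zero_or_pos n with rfl | hn
  · rw [Nat.cast_zero]
    rcases eq_or_ne (α - 1) 0 with h | h
    · rw [h, Real.rpow_zero]
    · rw [Real.zero_rpow h]; exact zero_le_one
  · exact Real.rpow_le_one_of_one_le_of_nonpos (by exact_mod_cast hn) (by linarith)

/-- **`|c(p)| ≤ 1`** for the comparison weight, `α ≤ 1`. [folklore] -/
theorem abs_selWeight_le (S : Set ℕ) (hα : α ≤ 1) (p : ℕ) : |selWeight S α p| ≤ 1 := by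
  unfold selWeight
  have h1 := indSet_mem_Icc S p
  have h2 := natCast_rpow_sub_one_mem_Icc hα p
  rw [abs_le]
  constructor <;> linarith [h1.1, h1.2, h2.1, h2.2]

/-- `1 ≤ g(t)`. [folklore] -/
theorem one_le_logGauge (t : ℝ) : 1 ≤ logGauge t := le_add_of_nonneg_right (Real.sqrt_nonneg _)

/-- `g(−t) = g(t)`. [folklore] -/
theorem logGauge_neg (t : ℝ) : logGauge (-t) = logGauge t := by unfold logGauge; rw [abs_neg]

/-- `g` is monotone in `|t|`: `|s| ≤ |t| → g(s) ≤ g(t)`. [folklore] -/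
theorem logGauge_mono {s t : ℝ} (h : |s| ≤ |t|) : logGauge s ≤ logGauge t := by
  unfold logGauge
  refine add_le_add le_rfl (Real.sqrt_le_sqrt (Real.log_le_log (by linarith [abs_nonneg s]) (by linarith)))

/-- `√log(|t|+2) ≤ g(t)` and `1 + √log(n+2) ≤ g(t)` for `n ≤ |t|`. [folklore] -/
theorem one_add_sqrt_log_le_logGauge {n : ℝ} (hn0 : 0 ≤ n) {t : ℝ} (hn : n ≤ |t|) :
    1 + Real.sqrt (Real.log (n + 2)) ≤ logGauge t := by
  unfold logGauge
  exact add_le_add le_rfl (Real.sqrt_le_sqrt (Real.log_le_log (by linarith) (by linarith)))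

open Classical in
/-- `wcount (indSet S) x = #{p ≤ x : p ∈ S}` counts the primes of `S` up to `x` (as a filtered cardinality). [folklore] -/
theorem wcount_indSet (S : Set ℕ) (x : ℝ) :
    wcount (indSet S) x = (((primesUpTo x).filter (· ∈ S)).card : ℝ) := by
  classical
  unfold wcount indSet
  rw [Finset.card_filter, Nat.cast_sum]
  refine Finset.sum_congr rfl fun p _ ↦ ?_
  split_ifs <;> simp

/-- `wcount (selWeight S α) = wcount (indSet S) − powCount α`. [folklore] -/
theorem wcount_selWeight (S : Set ℕ) (α x : ℝ) : wcount (selWeight S α) x = wcount (indSet S) x - powCount α x := by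
  unfold wcount selWeight powCount
  rw [Finset.sum_sub_distrib]

/-- `wsum (selWeight S α) = wsum (indSet S) − wsum (powWeight α)`. [folklore] -/
theorem wsum_selWeight (S : Set ℕ) (α x t : ℝ) :
    wsum (selWeight S α) x t = wsum (indSet S) x t - wsum (powWeight α) x t := by
  unfold wsum selWeight powWeight
  rw [← Finset.sum_sub_distrib]
  refine Finset.sum_congr rfl fun p _ ↦ ?_
  push_cast; ring

/-- `‖wsum (powWeight α) x t‖ ≤ F(x)`. [folklore] -/
theorem norm_wsum_powWeight_le (α x t : ℝ) : ‖wsum (powWeight α) x t‖ ≤ powCount α x := by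
  unfold wsum powCount powWeight
  refine (norm_sum_le _ _).trans (Finset.sum_le_sum fun p hp ↦ ?_)
  rw [norm_mul, Complex.norm_natCast_cpow_of_pos (mem_primesUpTo.mp hp).1.pos, Complex.norm_real,
    Real.norm_eq_abs, abs_of_pos (powWeight_pos (mem_primesUpTo.mp hp).1 α)]
  simp

/-- `‖wsum (indSet S) x t‖ ≤ wcount (indSet S) x` (`= #{p ≤ x : p ∈ S}`). [folklore] -/
theorem norm_wsum_indSet_le (S : Set ℕ) (x t : ℝ) : ‖wsum (indSet S) x t‖ ≤ wcount (indSet S) x := by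
  unfold wsum wcount
  refine (norm_sum_le _ _).trans (Finset.sum_le_sum fun p hp ↦ ?_)
  rw [norm_mul, Complex.norm_natCast_cpow_of_pos (mem_primesUpTo.mp hp).1.pos, Complex.norm_real,
    Real.norm_eq_abs, abs_of_nonneg (indSet_mem_Icc S p).1]
  simp

end PrimeWeight

end Literature.NumberTheory.BeurlingPrimes
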